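import Literature.NumberTheory.EllipticCurves.Sha
import Literature.NumberTheory.EllipticCurves.Selmer
import HarnessLib

/-!
# The Selmer group as the preimage of `Ш`, and the Kummer sequence (Silverman AEC X.4.2(a))

D-0014 decomposition file for the named fact `WeierstrassCurve.map_torsionH1ToH1_selmerGroup`
(`Literature.NumberTheory.EllipticCurves.Selmer`; Silverman, *AEC*, Thm. X.4.2(a): the image of
`Sel^(n)(E/K)` under `H¹(K, E[n]) → H¹(K, E)` is `Ш(E/K)[n]`), which together with X.4.2(b)
(`finite_selmerGroup`, decomposed in `SelmerUnramified`) yields `finite_sha_torsionBy`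
(`ShaProofs`).

Silverman's proof of X.4.2(a) (2nd ed., X.§4, pp. 331 ff.: "immediate from the diagram (**) and
the definitions") uses two ingredients, separated here:

* **Commutativity of (**)** — the local restriction `H¹(K, E) → H¹(K_v, E)` composed with
  `H¹(K, E[n]) → H¹(K, E)` is the map `H¹(K, E[n]) → H¹(K_v, E)` whose kernel defines the Selmer
  local condition. This is functoriality of continuous cohomology (Mathlib's
  `ContinuousCohomology.map_comp`) and is **proved** here:
  `torsionH1ToH1_comp_localRestriction`, `selmerLocalKer_eq_comap`, and globally
  `selmerGroup_eq_comap_sha : Sel^(n)(E/K) = (H¹(K, E[n]) → H¹(K, E))⁻¹ (Ш(E/K))`.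
* **The Kummer sequence for `E/K`** (Silverman VIII.§2, p. 215 ff.; the sequence (*) of X.§4):
  `0 → E(K)/mE(K) → H¹(G_K, E[m]) → H¹(G_K, E(K̄))[m] → 0` is exact; its surjectivity half,
  `im (H¹(K, E[n]) → H¹(K, E)) = H¹(K, E)[n]`, is vendored as the named fact
  `range_torsionH1ToH1_eq_torsionBy` (it needs the long exact cohomology sequence for discrete
  `Γ_K`-modules — a Mathlib TODO in `ContCohomology/Basic` — and the `n`-divisibility of `E(K̄)`,
  Silverman III.4.2(a)).

and the **assembly** `map_torsionH1ToH1_selmerGroup_of_isElliptic_of_kummer`: the Kummer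
surjectivity alone implies X.4.2(a) in the form
`(Sel^(n)).map (H¹(K, E[n]) → H¹(K, E)) = Ш ⊓ H¹(K, E)[n]` (`AddSubgroup.map_comap_eq`) for
*elliptic* `W` — the faithful statement `map_torsionH1ToH1_selmerGroup_of_isElliptic`. The tree's
`map_torsionH1ToH1_selmerGroup` omits `[W.IsElliptic]` (Silverman X.4.2 is about elliptic curves);
see the docstring of the corrected `Prop`. `ShaProofs` assembles `finite_sha_torsionBy` from the
elliptic form.

## Mathlib reuse

`ContinuousCohomology.map_comp` (functoriality of `Hⁿ_cont` in compatible pairs),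
`AddSubgroup.comap_iInf`, `AddSubgroup.map_comap_eq`. No new definitions.

## Design choices

* Group-wide rules of `Sha`/`Selmer`: `noncomputable section`, `open scoped Classical`, one named
  universe `u` with `K E : Type u`.
* The Kummer fact is stated for `n : ℤ`, `n ≠ 0` (Silverman: `m ≥ 2`); the cases `n = ±1`
  (`E[±1] = 0`, both sides `⊥`) and `n < 0` (`E[-m] = E[m]`, `A[-m] = A[m]`) are formal, matching
  the conventions of `torsionH1ToH1`, `finite_selmerGroup`, `finite_sha_torsionBy`.

## References

* J. H. Silverman, *The Arithmetic of Elliptic Curves*, 2nd ed., GTM 106, Springer 2009: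
  VIII.§2 (pp. 215 ff., the Kummer sequence for `E/K`), X.§4 (pp. 331 ff., diagram (**),
  Theorem 4.2(a)).
* J.-P. Serre, *Galois Cohomology*, 1997, I.§2.2 (exact sequences), I.§2.4 (compatible pairs).
-/

noncomputable section

open scoped Classical
open scoped AddSubgroup

open NumberField IsDedekindDomain CategoryTheory

universe u

namespace WeierstrassCurve

open Literature.NumberTheory.EllipticCurves

variable {K : Type u} [Field K] (W : WeierstrassCurve K) (E : Type u) [Field E] [Algebra K E]

/-! ## Commutativity of Silverman's diagram (**) -/

/-- **Commutativity of the diagram (**)** (Silverman, *AEC*, X.§4): the composite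
`H¹(K, E[n]) → H¹(K, E) → H¹(E, E(K̄_E))` (inclusion `E[n] ↪ E(K̄)` on coefficients, then
restriction along `Γ_E → Γ_K` with `E(K̄) → E(K̄_E)`) equals the map
`H¹(K, E[n]) → H¹(E, E(K̄_E))` along the composite compatible pair
`(resGal E, pointsMap ∘ (E[n] ↪ E(K̄)))` that defines the Selmer local condition. Functoriality of
continuous cohomology (`ContinuousCohomology.map_comp`).
Serre, *Galois Cohomology*, I.§2.4; Silverman, *AEC*, X.§4 (diagram (**)). [folklore] -/
theorem torsionH1ToH1_comp_localRestriction (n : ℤ) :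
    ContinuousCohomology.map (ContinuousMonoidHom.id (Field.absoluteGaloisGroup K))
      (resHomOfEquivariant (ContinuousMonoidHom.id (Field.absoluteGaloisGroup K))
        (geomTorsion W n).subtype (fun _ _ ↦ rfl)) 1 ≫ W.localRestriction E =
    ContinuousCohomology.map (resGal (K := K) E)
      (resHomOfEquivariant (resGal (K := K) E) ((pointsMap W E).comp (geomTorsion W n).subtype)
        (fun σ P ↦ by
          simp only [AddMonoidHom.coe_comp, AddSubgroup.coe_subtype, Function.comp_apply,
            Literature.NumberTheory.EllipticCurves.AddSubgroup.torsionBy.coe_smul]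
          exact pointsMap_smul W E σ P)) 1 := by
  rw [localRestriction, ← ContinuousCohomology.map_comp]
  rfl

/-- Pointwise form of the commutativity of (**): for `c ∈ H¹(K, E[n])`, the Selmer local map
sends `c` to the local restriction of its image in `H¹(K, E)`.
Silverman, *AEC*, X.§4 (diagram (**)). [folklore] -/
theorem selmerLocalMap_apply (n : ℤ) (c : galH1Torsion W n) :
    (ContinuousCohomology.map (resGal (K := K) E)
      (resHomOfEquivariant (resGal (K := K) E) ((pointsMap W E).comp (geomTorsion W n).subtype)
        (fun σ P ↦ by
          simp only [AddMonoidHom.coe_comp, AddSubgroup.coe_subtype, Function.comp_apply,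
            Literature.NumberTheory.EllipticCurves.AddSubgroup.torsionBy.coe_smul]
          exact pointsMap_smul W E σ P)) 1).hom c =
      W.localRestrictionHom E (torsionH1ToH1 W n c) := by
  rw [← torsionH1ToH1_comp_localRestriction]
  rfl

/-- The Selmer local condition at `E` is the preimage of the `Ш` local condition at `E`:
`ker (H¹(K, E[n]) → H¹(E, E)) = (H¹(K, E[n]) → H¹(K, E))⁻¹ (ker (H¹(K, E) → H¹(E, E)))`.
Silverman, *AEC*, X.§4 (diagram (**) and the definitions of `S^(φ)`, `Ш`). [folklore] -/
theorem selmerLocalKer_eq_comap (n : ℤ) :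
    selmerLocalKer W E n = (W.localRestrictionKer E).comap (torsionH1ToH1 W n) := by
  ext c
  rw [AddSubgroup.mem_comap, mem_localRestrictionKer_iff, ← selmerLocalMap_apply]
  rfl

section NumberField

variable [NumberField K]

/-- **`Sel^(n)(E/K)` is the preimage of `Ш(E/K)`** under `H¹(K, E[n]) → H¹(K, E)`:
`Sel^(n)(E/K) = {ξ ∈ H¹(K, E[n]) | image of ξ in H¹(K, E) lies in Ш(E/K)}` (both are defined by
vanishing in `H¹(K_v, E)` at every place, and the diagram (**) commutes).
Silverman, *AEC*, X.§4 (definitions of `S^(φ)(E/K)` and `Ш(E/K)`, diagram (**)). [folklore] -/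
theorem selmerGroup_eq_comap_sha (n : ℤ) :
    selmerGroup W n = W.sha.comap (torsionH1ToH1 W n) := by
  simp only [selmerGroup, sha, AddSubgroup.comap_inf, AddSubgroup.comap_iInf,
    selmerLocalKer_eq_comap]

/-- Consequently the image of `Sel^(n)(E/K)` in `H¹(K, E)` is `Ш(E/K) ∩ im (H¹(K, E[n]) → H¹(K, E))`
(unconditionally; the Kummer sequence identifies the image with `H¹(K, E)[n]`).
Silverman, *AEC*, X.§4. [folklore] -/
theorem map_torsionH1ToH1_selmerGroup_eq_sha_inf_range (n : ℤ) :
    (selmerGroup W n).map (torsionH1ToH1 W n) = W.sha ⊓ (torsionH1ToH1 W n).range := by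
  rw [selmerGroup_eq_comap_sha, AddSubgroup.map_comap_eq, inf_comm]

/-! ## The Kummer sequence for `E/K` (surjectivity half) -/

/-- **The Kummer sequence for `E/K`, surjectivity half** (Silverman, *AEC*, VIII.§2, p. 215 ff.;
the sequence (*) of X.§4). For an elliptic curve `E` over a number field `K` and `m ≥ 2`, taking
`G_{K̄/K}`-cohomology of `0 → E[m] → E(K̄) →[m] E(K̄) → 0` gives the exact *Kummer sequence*
`0 → E(K)/mE(K) → H¹(G_{K̄/K}, E[m]) → H¹(G_{K̄/K}, E(K̄))[m] → 0`; in particular the image of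
`H¹(K, E[m]) → H¹(K, E)` (the tree's `torsionH1ToH1 W m`) is exactly the `m`-torsion
`H¹(K, E)[m]`. Stated for `n : ℤ`, `n ≠ 0` (the cases `n = ±1`, where both sides are `⊥`, and
`n < 0`, where `E[-m] = E[m]` and `A[-m] = A[m]`, are formal). Its proof needs the long exact
sequence of continuous cohomology for discrete `Γ_K`-modules and the surjectivity of `[m]` on
`E(K̄)` (III.4.2(a)). The injectivity half / kernel `E(K)/mE(K)` is `exists_kummerMap` (`Selmer`).
[cite: SilvermanAEC2009, VIII.§2 (Kummer sequence for E/K) and X.§4 (*)] -/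
def range_torsionH1ToH1_eq_torsionBy : Prop :=
  ∀ [W.IsElliptic] {n : ℤ} (_hn : n ≠ 0),
    (torsionH1ToH1 W n).range = AddSubgroup.torsionBy W.galH1 n

/-! ## Assembly of X.4.2(a) -/

/-- **Silverman X.4.2(a) for elliptic curves** (corrected form of the tree's
`map_torsionH1ToH1_selmerGroup`): for an *elliptic* curve `E` over a number field and `n ≠ 0`,
the image of `Sel^(n)(E/K)` under `H¹(K, E[n]) → H¹(K, E)` is `Ш(E/K) ∩ H¹(K, E)[n] = Ш(E/K)[n]`
(surjectivity in `0 → E(K)/nE(K) → Sel^(n)(E/K) → Ш(E/K)[n] → 0`).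
Discrepancy: the named fact `WeierstrassCurve.map_torsionH1ToH1_selmerGroup` (`Selmer`) states
this for *every* Weierstrass curve over `K`, without `[W.IsElliptic]`; Silverman's Theorem X.4.2
(and the Kummer sequence VIII.§2 it rests on) is stated for elliptic curves only. (For a singular
cubic the statement happens to hold too — `E_ns(K̄) ≅ K̄⁺` or a form of `K̄ˣ`, III.2.5, is
`n`-divisible — but that is not the cited result.) This `Prop` is the faithful version; it is
what `finite_sha_torsionBy` (which does assume `[W.IsElliptic]`) needs.
[cite: SilvermanAEC2009, Thm. X.4.2(a)] -/
def map_torsionH1ToH1_selmerGroup_of_isElliptic : Prop :=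
  ∀ [W.IsElliptic] {n : ℤ} (_hn : n ≠ 0),
    (selmerGroup W n).map (torsionH1ToH1 W n) = W.sha ⊓ AddSubgroup.torsionBy W.galH1 n

/-- The tree's (stronger, `IsElliptic`-free) fact implies the faithful one. [folklore] -/
theorem map_torsionH1ToH1_selmerGroup_of_isElliptic_of_map (h : W.map_torsionH1ToH1_selmerGroup) :
    W.map_torsionH1ToH1_selmerGroup_of_isElliptic :=
  fun hn ↦ h hn

/-- **Assembly of Silverman X.4.2(a)** (elliptic form, the surjection `Sel^(n)(E/K) ↠ Ш(E/K)[n]`)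
from the Kummer sequence: since `Sel^(n)` is the preimage of `Ш` (`selmerGroup_eq_comap_sha`,
i.e. commutativity of (**)), its image is `Ш ∩ im (H¹(K, E[n]) → H¹(K, E)) = Ш ∩ H¹(K, E)[n]` by
`range_torsionH1ToH1_eq_torsionBy`. This is Silverman's "immediate from the diagram (**) and the
definitions". [cite: SilvermanAEC2009, Thm. X.4.2(a)] -/
theorem map_torsionH1ToH1_selmerGroup_of_isElliptic_of_kummer
    (h : W.range_torsionH1ToH1_eq_torsionBy) : W.map_torsionH1ToH1_selmerGroup_of_isElliptic := by
  intro _ n hn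
  rw [map_torsionH1ToH1_selmerGroup_eq_sha_inf_range, h hn]

/-! ## Assembly of `finite_sha_torsionBy` from the elliptic form of X.4.2(a) -/

/-- X.4.2(a) (elliptic form) + X.4.2(b) ⇒ `Ш(E/K) ∩ H¹(K, E)[n]` is finite for an elliptic curve
over a number field and `n ≠ 0`: it is the image of the finite group `Sel^(n)(E/K)`.
(Same argument as `finite_sha_inf_torsionBy_of_selmer` in `ShaProofs`, from the weaker, faithful
hypothesis `map_torsionH1ToH1_selmerGroup_of_isElliptic`.) [cite: SilvermanAEC2009, Thm. X.4.2] -/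
theorem finite_sha_inf_torsionBy_of_isElliptic (ha : W.map_torsionH1ToH1_selmerGroup_of_isElliptic)
    (hb : W.finite_selmerGroup) [W.IsElliptic] {n : ℤ} (hn : n ≠ 0) :
    Finite ↥(W.sha ⊓ AddSubgroup.torsionBy W.galH1 n) := by
  haveI : Finite (selmerGroup W n) := hb hn
  rw [← ha hn]
  have h : (((selmerGroup W n).map (torsionH1ToH1 W n) : AddSubgroup W.galH1) :
      Set W.galH1).Finite := by
    rw [AddSubgroup.coe_map]
    exact (Set.toFinite _).image _
  exact h.to_subtype

/-- X.4.2(a) (elliptic form) + X.4.2(b) ⇒ `finite_sha_torsionBy W`: `Ш(E/K)[n]` embeds by the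
subtype map into the finite subgroup `Ш ∩ H¹(K, E)[n]` of `H¹(K, E)`.
[cite: SilvermanAEC2009, Thm. X.4.2] -/
theorem finite_sha_torsionBy_of_isElliptic (ha : W.map_torsionH1ToH1_selmerGroup_of_isElliptic)
    (hb : W.finite_selmerGroup) : W.finite_sha_torsionBy := by
  intro _ n hn
  haveI := W.finite_sha_inf_torsionBy_of_isElliptic ha hb hn
  refine Finite.of_injective
    (fun x : AddSubgroup.torsionBy W.sha n =>
      (⟨((x : W.sha) : W.galH1), ?_⟩ : ↥(W.sha ⊓ AddSubgroup.torsionBy W.galH1 n))) ?_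
  · refine ⟨(x : W.sha).2, ?_⟩
    have hx : n • (x : W.sha) = 0 := (Submodule.mem_torsionBy_iff n (x : W.sha)).mp x.2
    change n • ((x : W.sha) : W.galH1) = 0
    rw [← AddSubgroup.coe_zsmul, hx, AddSubgroup.coe_zero]
  · intro x y hxy
    exact Subtype.ext (Subtype.ext (Subtype.mk.inj hxy))

/-- **`finite_sha_torsionBy` from the Kummer sequence and the finiteness of the Selmer group**:
Silverman's proof of the finiteness of `Ш(E/K)[n]` (X.4.2) with the diagram chase (**) done in
Lean, leaving exactly the two deep inputs as named facts — the Kummer surjectivity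
`range_torsionH1ToH1_eq_torsionBy` (VIII.§2) and `finite_selmerGroup` (X.4.2(b), itself reduced
to Lemma X.4.3 and Cor. X.4.4 in `SelmerUnramified`). [cite: SilvermanAEC2009, Thm. X.4.2] -/
theorem finite_sha_torsionBy_of_kummer (hk : W.range_torsionH1ToH1_eq_torsionBy)
    (hb : W.finite_selmerGroup) : W.finite_sha_torsionBy :=
  W.finite_sha_torsionBy_of_isElliptic (W.map_torsionH1ToH1_selmerGroup_of_isElliptic_of_kummer hk)
    hb

end NumberField

end WeierstrassCurve
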